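import Mathlib
import Literature.MathematicalPhysics.QuantumFieldTheory.Balaban1983to89.MatrixLog

/-!
# `Balaban1983to89.B14Eq119SecondFunction` — [Balaban1988Convergent] (1.19) p. 250: «Thus the second function in
the product (1.19) is equal to 1, and we can omit it»

HONEST FRAMING (cell `lit-balaban`, verbatim): statement-level skeleton of published theorems with citation tags;
proofs where landed; nothing here is a claim about the Yang–Mills mass gap.

CITATION HEADER.  T. Bałaban, *Convergent renormalization expansions for lattice gauge theories*, Commun. Math.
Phys. **119** (1988) 243–285, doi:10.1007/bf01217741 [Balaban1988Convergent] (cell paper B14 = "[III]"; held text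
`paper:balaban1988-cmp119-convergent-renormalization`, journal page = PDF page + 242; (1.18)–(1.19) and the
sentences after them READ AS AN IMAGE from the page render
`b2b-balaban-ref1/pages/1988-cmp119-convergent-renormalization/…-p008-x2.png`, p. 250).  Unit `lit-balaban-r11`
(reader/typer of B14), SKELETON row `B14.Eq1.18–1.19` (the decomposition of unity (1.18) is PROVED concretely in
`B14Eq124Jacobians.eq118`; the invariance aspect is `T4AdjointCovariance.*`; THIS file: the in-proof claim that the
second characteristic function of (1.19) equals 1).  The unitary exponential bound is the tree's [Balaban1985Averaging]
(24) `MatrixLog.norm_expUnitary_sub_one_le`, reused BY NAME.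

WHAT IS PRINTED (p. 250 [PDF 8], verbatim up to typography).  *«Consider a cube □′ ⊂ R₁ᶜ. For this cube we now have
the product of the two characteristic functions,
    χ({sup_{b∈(□′^{~2})*} |A(b)| < g₀⁻¹δ₀}) · χ({sup_{b∈(□′^{~2})*} |exp ig₀A(b) U₁(b) U_{1,□′}⁻¹(b) − 1| < 2δ₀}).   (1.19)
The cube □′^{~4} is contained in Ω₁, and both configurations U₁, U_{1,□′} are determined by the same configuration
V on □′^{~3}, hence on □′^{~2} the difference between these configurations is very small. More precisely
|U₁U_{1,□′}⁻¹ − 1| < O(1)B₃·exp(−δLM₂R₁)ε₁, and the bound can be made much smaller than δ₀, if M₂R₁ is large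
enough. Thus the second function in the product (1.19) is equal to 1, and we can omit it.»*

THE ARGUMENT AND HOW IT IS FORMALIZED.  On the support of the first function every bond variable `x = g₀A(b)` is a
self-adjoint element with `‖x‖ < δ₀`, so `‖e^{ix} − 1‖ ≤ ‖x‖ < δ₀` ([B7] (24), `MatrixLog.norm_expUnitary_sub_one_le`);
with `W = U₁(b)U_{1,□′}⁻¹(b)`, `‖W − 1‖ ≤ ε` and the algebra `e^{ix}W − 1 = (e^{ix} − 1)W + (W − 1)` one gets
`‖e^{ix}W − 1‖ ≤ ‖e^{ix} − 1‖(1 + ε) + ε < δ₀(1 + ε) + ε ≤ 2δ₀` as soon as `ε ≤ δ₀/2`, `δ₀ ≤ 1` («much smaller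
than δ₀»; `norm_mul_sub_one_le`, `norm_mul_sub_one_lt_two_mul`, `eq119_bond_lt`), for EVERY bond of (□′^{~2})*, hence
the sup is `< 2δ₀` and the characteristic function is 1 (`secondFunction_eq_one`).  «The bound can be made much
smaller than δ₀, if M₂R₁ is large enough»: `C·B₃·exp(−δL·M₂R₁)·ε₁ ≤ δ₀/2` as soon as
`M₂R₁ ≥ log(2CB₃ε₁/δ₀)/(δL)` (`small_if_M2R1_large`, explicit threshold).

WHAT IS PROVED (kernel-checked, no `sorry`, standard axioms): everything below; one definition (`secondFunction`, the
indicator of (1.19)₂ over a finite bond set).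

WHAT IS NOT PROVED HERE (and not claimed): the bound `|U₁U_{1,□′}⁻¹ − 1| < O(1)B₃exp(−δLM₂R₁)ε₁` itself (it is
[B11] (190) / the determining-set locality of (1.2), rows `B11.Eq190`, `B14.Eq1.2` — entered as the hypothesis `hW`);
the geometric sentences (□′^{~4} ⊂ Ω₁, determination by V on □′^{~3}).  NOT summit progress: an in-proof sentence of
B14 §1 with its two-line mechanism proved.
-/

namespace Literature.MathematicalPhysics.QuantumFieldTheory.Balaban1983to89.B14.Eq119SecondFunction

open selfAdjoint

/-! ## §1. The algebra: `‖aW − 1‖ ≤ ‖a − 1‖(1 + ‖W − 1‖) + ‖W − 1‖` -/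

section Ring

variable {R : Type*} [NormedRing R] [NormOneClass R]

/-- `aW − 1 = (a − 1)W + (W − 1)`, hence `‖aW − 1‖ ≤ ‖a − 1‖(1 + ‖W − 1‖) + ‖W − 1‖`.
[cite: Balaban1988Convergent, (1.19) p.250] (elementary API) -/
theorem norm_mul_sub_one_le (a W : R) : ‖a * W - 1‖ ≤ ‖a - 1‖ * (1 + ‖W - 1‖) + ‖W - 1‖ := by
  have h : a * W - 1 = (a - 1) * W + (W - 1) := by noncomm_ring
  have hW : ‖W‖ ≤ 1 + ‖W - 1‖ := by
    calc ‖W‖ = ‖1 + (W - 1)‖ := by rw [add_sub_cancel]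
      _ ≤ ‖(1 : R)‖ + ‖W - 1‖ := norm_add_le _ _
      _ = 1 + ‖W - 1‖ := by rw [norm_one]
  rw [h]
  calc ‖(a - 1) * W + (W - 1)‖ ≤ ‖(a - 1) * W‖ + ‖W - 1‖ := norm_add_le _ _
    _ ≤ ‖a - 1‖ * ‖W‖ + ‖W - 1‖ := by gcongr; exact norm_mul_le _ _
    _ ≤ ‖a - 1‖ * (1 + ‖W - 1‖) + ‖W - 1‖ := by gcongr

/-- **«the bound can be made much smaller than δ₀ … Thus the second function … is equal to 1»**, the inequality:
`‖a − 1‖ < δ₀`, `‖W − 1‖ ≤ ε`, `ε ≤ δ₀/2`, `δ₀ ≤ 1` give `‖aW − 1‖ < 2δ₀` (in print `a = exp ig₀A(b)`,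
`W = U₁(b)U_{1,□′}⁻¹(b)`). [cite: Balaban1988Convergent, (1.19) p.250] -/
theorem norm_mul_sub_one_lt_two_mul {a W : R} {δ₀ ε : ℝ} (ha : ‖a - 1‖ < δ₀) (hW : ‖W - 1‖ ≤ ε)
    (hε : ε ≤ δ₀ / 2) (hδ₀ : δ₀ ≤ 1) : ‖a * W - 1‖ < 2 * δ₀ := by
  have hε0 : 0 ≤ ε := (norm_nonneg _).trans hW
  have hδ0 : 0 < δ₀ := (norm_nonneg _).trans_lt ha
  have h1 : ‖a - 1‖ * (1 + ‖W - 1‖) ≤ ‖a - 1‖ * (1 + ε) := by gcongr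
  have h2 : ‖a - 1‖ * (1 + ε) < δ₀ * (1 + ε) := mul_lt_mul_of_pos_right ha (by linarith)
  calc ‖a * W - 1‖ ≤ ‖a - 1‖ * (1 + ‖W - 1‖) + ‖W - 1‖ := norm_mul_sub_one_le a W
    _ < δ₀ * (1 + ε) + ε := by linarith
    _ ≤ δ₀ * (1 + δ₀ / 2) + δ₀ / 2 := by nlinarith
    _ ≤ 2 * δ₀ := by nlinarith

end Ring

/-! ## §2. (1.19)₂ for one bond in a C⋆-algebra: `‖e^{ig₀A(b)} U₁(b)U_{1,□′}⁻¹(b) − 1‖ < 2δ₀` -/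

section CStar

variable {A : Type*} [CStarAlgebra A]

/-- **The second function of (1.19), bondwise**: if the bond variable `x = g₀A(b)` (self-adjoint) has `‖x‖ < δ₀`
(the support of the first function of (1.19)), and `W = U₁(b)U_{1,□′}⁻¹(b)` has `‖W − 1‖ ≤ ε` with `ε ≤ δ₀/2`
(«much smaller than δ₀»), `δ₀ ≤ 1`, then `‖e^{ix}W − 1‖ < 2δ₀` — by `‖e^{ix} − 1‖ ≤ ‖x‖` ([B7] (24),
`MatrixLog.norm_expUnitary_sub_one_le`). [cite: Balaban1988Convergent, (1.19) p.250] -/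
theorem eq119_bond_lt (x : selfAdjoint A) (W : A) {δ₀ ε : ℝ} (hx : ‖x‖ < δ₀) (hW : ‖W - 1‖ ≤ ε)
    (hε : ε ≤ δ₀ / 2) (hδ₀ : δ₀ ≤ 1) : ‖(expUnitary x : A) * W - 1‖ < 2 * δ₀ := by
  have hx0 : x ≠ 0 ∨ x = 0 := (eq_or_ne x 0).symm
  rcases hx0 with hxne | hx0
  · haveI : Nontrivial A := ⟨⟨(x : A), 0, by simpa using hxne⟩⟩
    exact norm_mul_sub_one_lt_two_mul ((MatrixLog.norm_expUnitary_sub_one_le x).trans_lt hx) hW hε hδ₀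
  · -- degenerate case x = 0: e^{i0} = 1 and ‖W − 1‖ ≤ ε ≤ δ₀/2 < 2δ₀
    subst hx0
    have hδ0 : 0 < δ₀ := (norm_nonneg _).trans_lt hx
    have h1 : ((expUnitary (0 : selfAdjoint A) : unitary A) : A) = 1 := by simp
    rw [h1, one_mul]
    linarith [(norm_nonneg (W - 1)).trans hW]

/-- **(1.19)₂ as an indicator** over the finite bond set `(□′^{~2})*`: `χ({sup_b ‖f(b) − 1‖ < 2δ₀})`.
[cite: Balaban1988Convergent, (1.19) p.250] -/
noncomputable def secondFunction {β : Type*} (bonds : Finset β) (f : β → A) (δ₀ : ℝ) : ℝ :=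
  if ∀ b ∈ bonds, ‖f b - 1‖ < 2 * δ₀ then 1 else 0

/-- **«Thus the second function in the product (1.19) is equal to 1, and we can omit it»**: on the support of the
first function (`‖g₀A(b)‖ < δ₀` for all bonds) and under `‖U₁(b)U_{1,□′}⁻¹(b) − 1‖ ≤ ε ≤ δ₀/2`, `δ₀ ≤ 1`, the
indicator of `{sup_b ‖e^{ig₀A(b)}U₁(b)U_{1,□′}⁻¹(b) − 1‖ < 2δ₀}` is `1`. [cite: Balaban1988Convergent, (1.19) p.250] -/
theorem secondFunction_eq_one {β : Type*} (bonds : Finset β) (x : β → selfAdjoint A) (W : β → A) {δ₀ ε : ℝ}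
    (hx : ∀ b ∈ bonds, ‖x b‖ < δ₀) (hW : ∀ b ∈ bonds, ‖W b - 1‖ ≤ ε) (hε : ε ≤ δ₀ / 2) (hδ₀ : δ₀ ≤ 1) :
    secondFunction bonds (fun b => (expUnitary (x b) : A) * W b) δ₀ = 1 := by
  unfold secondFunction
  rw [if_pos]
  intro b hb
  exact eq119_bond_lt (x b) (W b) (hx b hb) (hW b hb) hε hδ₀

end CStar

/-! ## §3. «the bound can be made much smaller than δ₀, if M₂R₁ is large enough» -/

/-- **The threshold**: for `C, B₃, ε₁, δ₀, δ, L > 0` and `M₂R₁ ≥ log(2CB₃ε₁/δ₀)/(δL)`,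
`C·B₃·exp(−δL·M₂R₁)·ε₁ ≤ δ₀/2`. [cite: Balaban1988Convergent, (1.19) p.250] -/
theorem small_if_M2R1_large {C B₃ ε₁ δ₀ δ L m : ℝ} (hC : 0 < C) (hB : 0 < B₃) (hε : 0 < ε₁) (hδ₀ : 0 < δ₀)
    (hδ : 0 < δ) (hL : 0 < L) (hm : Real.log (2 * C * B₃ * ε₁ / δ₀) / (δ * L) ≤ m) :
    C * B₃ * Real.exp (-(δ * L * m)) * ε₁ ≤ δ₀ / 2 := by
  have hK : 0 < 2 * C * B₃ * ε₁ / δ₀ := by positivity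
  have hδL : 0 < δ * L := mul_pos hδ hL
  have hlog : Real.log (2 * C * B₃ * ε₁ / δ₀) ≤ δ * L * m := by
    rw [div_le_iff₀ hδL] at hm
    linarith [mul_comm m (δ * L)]
  have hexp : Real.exp (-(δ * L * m)) ≤ δ₀ / (2 * C * B₃ * ε₁) := by
    have h1 : Real.exp (-(δ * L * m)) ≤ Real.exp (-Real.log (2 * C * B₃ * ε₁ / δ₀)) :=
      Real.exp_le_exp.mpr (by linarith)
    have h2 : Real.exp (-Real.log (2 * C * B₃ * ε₁ / δ₀)) = δ₀ / (2 * C * B₃ * ε₁) := by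
      rw [Real.exp_neg, Real.exp_log hK, inv_div]
    exact h1.trans h2.le
  calc C * B₃ * Real.exp (-(δ * L * m)) * ε₁ ≤ C * B₃ * (δ₀ / (2 * C * B₃ * ε₁)) * ε₁ := by gcongr
    _ = δ₀ / 2 := by field_simp

end Literature.MathematicalPhysics.QuantumFieldTheory.Balaban1983to89.B14.Eq119SecondFunction
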